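import Summits.QuantumFields.YangMills.Theorems.BalabanUVNodesClustersCore

/-!
# BalabanUVNodes ∕ Clusters (1∕3), §§5–6 — THE JOINS (kernel, for every `Rec`, `SRec`, `Inputs`) and the LADDER GLUE at `N = 2`;
# §§1–4 (carriers, parameters, rung + tether, stub signatures, cluster statements) are `BalabanUVNodesClustersCore.lean` (imported)

MAINTENANCE NOTE (leaf split, R201, 2026-08-27): §6 (the ladder glue AT the leaf `…Theses.BalabanLadder.UV`: `ladderUV_of_clusters`, `ladderUV_of_clusters₄`, `apex_of_ladderUV`, `uvApex_of_ladderUV`) moved VERBATIM, same names and namespace, to `Summits.QuantumFields.YangMills.Theorems.BalabanUVNodesClustersLeaf` (which imports this module and `Theses.BalabanLadder`); §5 below is byte-identical.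

SUPPLY TEXT = b2b-balaban-t4-dagwriter v3 98f4c88edf268b6b (gen 82), SPLIT IN TWO FILES AT THE §4∕§5 BOUNDARY by the courier (pub-ymgap-dag-p2, 2026-08-26)
for the gate's lint «Theorems files with proofs are ≤ 400 lines» — every declaration, statement, proof, docstring and name (namespace `YMDAG.UVSplit`) is
byte-identical to v3; only the file boundary is new.  THIS file keeps the module name `BalabanUVNodesClusters` that modules 2–6 of the chain and the staged
consumers import, so no consumer byte changes.  The module docstring of record (tether ∕ N08 ∕ namespace answers to review p409153, the rung of record, the
one design decision, the cut R420 (C), honest framing) is in the Core file and applies verbatim; the `closes` shape of the route lands here: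
`uvD59_of_clusters : KnitIR → FlowBounds → RenormalisationBeta → SpineRates → SpineMatching → UVD59 N` and, at `N = 2`, `ladderUV_of_clusters` on the
leaf `Summit.QuantumFields.YangMills.Theses.BalabanLadder.UV` by name.

HONEST FRAMING.  Bookkeeping only: joins = compositions of tree theorems over the PARAMETERS `Rec`, `SRec`, `Inputs`; 0 `sorry`, 0 `def`, standard
axioms.  NOTHING of Bałaban's is asserted, no node is discharged; [B12] Thm 2 unproved in print; NE7 ∕ NE7b ∕ NE7c not proved; ONE finite four-torus
programme — NOT infinite volume, NOT OS on ℝ⁴, NOT a mass gap, NOT Clay.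
-/

namespace YMDAG.UVSplit

open Literature.MathematicalPhysics.QuantumFieldTheory.Balaban1983to89
open Literature.MathematicalPhysics.QuantumFieldTheory.Balaban1983to89.T4Continuum
open Summit.QuantumFields.BalabanUV.T4Continuum.Spine

section Split

variable {N : ℕ} [NeZero N] (Rec : RecordPred N) (SRec : SpineRecordPred N) (Inputs : InputsPred N)

/-! ## §5 THE JOINS (kernel, for every `Rec`, `SRec`, `Inputs`) -/

/-- K1 join. -/
theorem KnitIR_of (hW : S_W00 Rec) (h1 : S_N01 Rec) (h2 : S_N02 Rec) (h23 : S_N23 Rec) : KnitIR Rec := by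
  refine ⟨hW.1, fun F D w hR => ?_⟩
  obtain ⟨hC, hγ, hrg⟩ := hW.2 F D w hR
  exact ⟨hC, hγ, hrg, h23 F D w hR, h1 F D w hR, h2 F D w hR⟩

/-- K2 join. -/
theorem FlowBounds_of (h3 : S_N03 Rec) (h6 : S_N06 Rec) (h10 : S_N10 Rec) (h9 : S_N09 Rec) (h11 : S_N11 Rec) (h13 : S_N13 Rec) :
    FlowBounds Rec := by
  intro F D w hR P
  exact ⟨h3 F D w hR P, h6 F D w hR P, h10 F D w hR P, h9 F D w hR P, h11 F D w hR P, h13 F D w hR P⟩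

/-- K3 join. -/
theorem RenormalisationBeta_of (h4 : S_N04 Rec) (h5 : S_N05 Rec) (h7 : S_N07 Rec) (h8 : S_N08 Rec) (h12 : S_N12 Rec)
    (h25 : S_N25 Rec) (hβ : S_BetaSide Rec) : RenormalisationBeta Rec := by
  intro F D w hR
  exact ⟨fun P => ⟨h4 F D w hR P, h5 F D w hR P, h7 F D w hR P, h8 F D w hR P, h12 F D w hR P⟩, h25 F D w hR, hβ F D w hR⟩

/-- K5 join: the expansion of record (N27x) with NE7b (N20), NE7c (N21), the edge N19 and U4′ at its carriers IS, given the in-edges, the spine datum —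
for all small-coupling tuned runs (`ForSmallCouplings.mono`). -/
theorem SpineMatching_of (hx : S_N27x Rec SRec) (h20 : S_N20 SRec) (h21 : S_N21 SRec) (h19 : S_N19 SRec Inputs) (hU4 : S_U4 SRec) :
    SpineMatching Rec Inputs := by
  intro F D w hR hB hEnd
  refine (hx F D w hR hB hEnd).mono fun g₀ hg os hin => ?_
  obtain ⟨S, hS, hl₀, hvol, hZA, hZB⟩ := hg os
  exact ⟨S.ι, S.dec, S.l₀, S.vol, S.K₀, S.T, S.A, S.B, S.shA, S.shB, S.Bad, S.W, S.Wsh, S.δ, hl₀, hvol,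
    h20 F D g₀ os S hS, h21 F D g₀ os S hS, h19 F D g₀ os S hS hin, (hU4 F D g₀ os S hS).1, (hU4 F D g₀ os S hS).2, hZA, hZB⟩

/-- The spine datum on a string IS the apex's per-string hybrid-NE7 shape (`Spine.NE7.hybridNE7_of_core` BY NAME; = g73 `spineDatum_iff`, mp). -/
theorem stringHybridNE7_of_spineDatum {F : T4Family} (D : Datum F N) (g₀ : ℕ → ℝ)
    (h : ∀ os : List (ULoop F), SpineDatum D g₀ os) : T4ApexHybrid.StringwiseHybridNE7 (D.scheme g₀) := fun os => by
  obtain ⟨ι, _, l₀, vol, K₀, T, A, B, shA, shB, Bad, W, Wsh, δ, hl₀, hvol, hW, hSh, hcore, hlt, hδ, hZA, hZB⟩ := h os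
  exact ⟨l₀, vol, K₀, hl₀, hvol, ι, ‹_›, T, A, B, shA, shB, Bad, W, Wsh, δ, NE7.hybridNE7_of_core hW hSh hlt hδ hcore, hZA, hZB⟩

/-- **GLUE N27 = B5 AT THE RECORD (kernel)**: K4 «SpineRates» and K5 «SpineMatching» give binder B5 at every record pair — the two `ForSmallCouplings`
conclusions are conjoined at the smaller thresholds (`ForSmallCouplings.and`), modus ponens per string, then `stringHybridNE7_of_spineDatum`;
`HybridNE7Under D END` is `(B) → END → ForSmallCouplings …` definitionally (`underHypotheses_iff`). K4 IS CONSUMED HERE. -/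
theorem B5_at_record (h4 : SpineRates Rec Inputs) (h5 : SpineMatching Rec Inputs) : Spine Rec := by
  intro F D w hR
  show D.UnderHypotheses _ fun g₀ => T4ApexHybrid.StringwiseHybridNE7 (D.scheme g₀)
  intro hB hEnd
  exact ((h4 F D w hR hB hEnd).and (h5 F D w hR hB hEnd)).mono fun g₀ hg =>
    stringHybridNE7_of_spineDatum D g₀ fun os => hg.2 os (hg.1 os)

/-- The thirteen paper nodes at the record from K1's frame, K2 and K3 (the conjunction `DagBinding.Nodes`, paper order B4 … B16). -/
theorem nodes_at_record (h1 : KnitIR Rec) (h2 : FlowBounds Rec) (h3 : RenormalisationBeta Rec) : AtRecord Rec DagBinding.Nodes := by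
  intro F D w hR P
  have fr := h1.2 F D w hR
  obtain ⟨h6, h9, h13, h12, h14, h16⟩ := h2 F D w hR P
  obtain ⟨h7, h8, h11, h10, h15⟩ := (h3 F D w hR).1 P
  exact ⟨fr.b4 P, fr.b5 P, h6, h7, h8, h9, h10, h11, h12, h13, h14, h15, h16⟩

/-- **GLUE N24 = B2 AT THE RECORD (kernel)**: (B) for the datum's construction from K1, K2, K3 — `DagBinding.endStatementBPrinted_of_nodesP_interval`
at the world, transported along `w.C = D.C` (venue `Dag.B2_of_nodes`). -/
theorem B2_at_record (h1 : KnitIR Rec) (h2 : FlowBounds Rec) (h3 : RenormalisationBeta Rec) :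
    ∀ (F : T4Family) (D : Datum F N) (w : DagBinding.WorldP), Rec F D w → B16.EndStatementBPrinted D.C := by
  intro F D w hR
  have fr := h1.2 F D w hR
  obtain ⟨γ₀, hγ₀, hβ⟩ := (h3 F D w hR).2.2
  have hBw : B16.EndStatementBPrinted w.C :=
    DagBinding.endStatementBPrinted_of_nodesP_interval w fr.gamma_pos hγ₀
      (fun P => nodes_at_record Rec h1 h2 h3 F D w hR P) fr.rg hβ
  rw [← fr.construction]
  exact hBw

/-- **`uvD59_of_clusters₄` — THE TOP JOIN, merged-spine form (kernel)**: K1 «KnitIR» → K2 «FlowBounds» → K3 «RenormalisationBeta» → «Spine» (B5 at the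
record) → `UVD59 N`.  (The shape of ym-beyond's `route edit --split UV --into …` glue under LINE №4 (B), ≤ 5 children.) -/
theorem uvD59_of_clusters₄ (h1 : KnitIR Rec) (h2 : FlowBounds Rec) (h3 : RenormalisationBeta Rec) (hS : Spine Rec) : UVD59 N := by
  intro F
  obtain ⟨D, w, hR⟩ := h1.1 F
  exact ⟨D, (h1.2 F D w hR).datum₀, B2_at_record Rec h1 h2 h3 F D w hR, (h3 F D w hR).2.1, hS F D w hR⟩

/-- **`uvD59_of_clusters` — THE TOP JOIN IN R420's CUT (kernel)**: K1 → K2 → K3 → K4 «SpineRates» → K5 «SpineMatching» → `UVD59 N`, every cluster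
LOAD-BEARING in the term (K6 «NodeOAcrossSmall» enters once its consumer edge into N10∕N18 is typed — R420 (C)). The `closes` shape of «BalabanUVNodes». -/
theorem uvD59_of_clusters (h1 : KnitIR Rec) (h2 : FlowBounds Rec) (h3 : RenormalisationBeta Rec) (h4 : SpineRates Rec Inputs)
    (h5 : SpineMatching Rec Inputs) : UVD59 N :=
  uvD59_of_clusters₄ Rec h1 h2 h3 (B5_at_record Rec Inputs h4 h5)

/-- All the way to the apex's closed ∃-form (kernel), on any family. -/
theorem uvApex_of_clusters (F : T4Family) (h1 : KnitIR Rec) (h2 : FlowBounds Rec) (h3 : RenormalisationBeta Rec)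
    (h4 : SpineRates Rec Inputs) (h5 : SpineMatching Rec Inputs) : UVApex N :=
  uvApex_of_uvD59 (uvD59_of_clusters Rec Inputs h1 h2 h3 h4 h5) F

end Split

end YMDAG.UVSplit
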